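import Summits.ResolutionOfSingularities.ResolutionOfSingularities.Theorems.PurelyInseparableDim4JointHereditaryChildren
import Summits.ResolutionOfSingularities.ResolutionOfSingularities.Theorems.PurelyInseparableDim4JointWaitingKidShape
import Summits.ResolutionOfSingularities.ResolutionOfSingularities.Theorems.PurelyInseparableDim4JointWaitingStepSees
import HarnessLib

/-!
# Purely inseparable four-folds: the STEP of the joint forest at a host with HEREDITARY waiting (brick S3 (c), part 61d = v3-H; cell `res-dim4-pi`)

[OURS · counted 0] (D-0157 DOOR 2; host item stmt-ResolutionOfSingularities-16155, helper). Nothing here proves resolution of singularities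
in dimension ≥ 4 / characteristic `p`. Part 37e in the v3-H format: the blown-up member's CHILDREN come with their hereditary waiting regions
(part 61c), its OWN waiting entries (z-form regions seen by the host chart, permissible for the host state translated to `c`, every boundary
component meeting the region meets the host) become waiting kids through part 58; pairwise disjointness child/child, child/kid, kid/kid,
region/other child, region/kid, region/region; the FOUR-WAY COVER over the host (child / waiting kid / hereditary region / listed leaf with
a zigzag chart); off-host order-`p` points over a waiting region lie on its kid; the leaf points are finitely many.
* **`joint_forest_step_hereditary`**. AI-produced formalisation, weaker than expert review.
bears_on: LADDER-RESOLUTION:D157-DOOR2 (res-dim4-pi · S3 (c) joint v3-H · step).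
-/

set_option linter.dupNamespace false -- D-0017: single-problem summit path `Summit.<S>.<S>.…` by design

noncomputable section

open MvPolynomial Finset CategoryTheory AlgebraicGeometry Opposite TopologicalSpace
open AlgebraicGeometry.Scheme.IdealSheafData (ofIdealTop vanishingIdeal)

namespace Summit.ResolutionOfSingularities.ResolutionOfSingularities.Theorems.PIDim4

open Literature.AlgebraicGeometry.Resolution
open Literature.AlgebraicGeometry.Resolution.Hauser2010
open Literature.AlgebraicGeometry.Resolution.AffinePointBlowup (P A γ coord Wtop ξ)

namespace Equimultiple

section StepH

variable {K : Type} [Field K] {p : ℕ} [hp : Fact p.Prime] [CharP K p] [DecidableEq K]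
variable {Z Y W Bl : Scheme.{0}} (φ : Y ⟶ Z) [IsOpenImmersion φ] (ψ : Y ⟶ P 4 K) [IsOpenImmersion ψ]
  {π : W ⟶ Z} {B : Bl ⟶ P 4 K} {S : Finset (Fin 4)}
  (ε : (π ⁻¹ᵁ φ.opensRange : Scheme.{0}) ≅ (B ⁻¹ᵁ ψ.opensRange : Scheme.{0}))

/-- **THE STEP OF THE JOINT FOREST AT A HOST WITH HEREDITARY WAITING, FOUR-WAY COVER.** See the module docstring.
[cite: BierstoneGrigorievMilmanWlodarczyk2011, Def. 3.1.3; §4 Step 2b] [cite: Hauser2010, §§F–G] [cite: GortzWedhorn2020, Prop. 13.91] -/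
theorem joint_forest_step_hereditary [IsLocallyNoetherian Z] [IsAlgClosed K] (Zc : Z.IdealSheafData)
    (hπ : IsBlowup π Zc) (hB : IsBlowup B (AffineCoordBlowup.𝓘Λ 4 K (insert 0 (Fin.succ '' (S : Set (Fin 4))))))
    (hsq : ε.hom ≫ (B ∣_ ψ.opensRange) = (π ∣_ φ.opensRange) ≫ (φ.isoOpensRange.inv ≫ ψ.isoOpensRange.hom))
    (hC' : ((AffineCoordBlowup.𝓘Λ 4 K (insert 0 (Fin.succ '' (S : Set (Fin 4))))).comap ψ.opensRange.ι).comap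
        (φ.isoOpensRange.inv ≫ ψ.isoOpensRange.hom) = Zc.comap φ.opensRange.ι)
    (M : MarkedIdeal Z) (hmult : M.mult = p) (s : State K)
    (hK : ((controlledTransform B (AffineCoordBlowup.𝓘Λ 4 K (insert 0 (Fin.succ '' (S : Set (Fin 4)))))
        (hypSheaf p s.F) p).comap (B ⁻¹ᵁ ψ.opensRange).ι).comap ε.hom =
      (controlledTransform π Zc M.ideal p).comap (π ⁻¹ᵁ φ.opensRange).ι) (hS : IsPermissibleCentre p S s.F)
    (hsee : (AffineCoordBlowup.CΛ 4 K (insert 0 (Fin.succ '' (S : Set (Fin 4)))) : Set (P 4 K)) ⊆ Set.range ψ) (hT : IsClosed (φ '' (ψ ⁻¹' (AffineCoordBlowup.CΛ 4 K (insert 0 (Fin.succ '' (S : Set (Fin 4)))) : Set (P 4 K)))))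
    (hsncZ : HasSNCWith M.boundary Zc) (idx : Z.IdealSheafData → Fin 4) (cst : Z.IdealSheafData → K)
    (hshape : ∀ D ∈ M.boundary, ((D.support : Set Z) ∩ φ '' (ψ ⁻¹' (AffineCoordBlowup.CΛ 4 K (insert 0 (Fin.succ '' (S : Set (Fin 4)))) : Set (P 4 K)))).Nonempty →
      D.comap φ = (ofIdealTop (Ideal.span {(γ 4 K).symm (X (idx D).succ + C (cst D))})).comap ψ ∧
        (idx D ∈ S → cst D = 0))
    (hinj : ∀ D₁ ∈ M.boundary, ∀ D₂ ∈ M.boundary,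
      ((D₁.support : Set Z) ∩ φ '' (ψ ⁻¹' (AffineCoordBlowup.CΛ 4 K (insert 0 (Fin.succ '' (S : Set (Fin 4)))) : Set (P 4 K)))).Nonempty → ((D₂.support : Set Z) ∩ φ '' (ψ ⁻¹' (AffineCoordBlowup.CΛ 4 K (insert 0 (Fin.succ '' (S : Set (Fin 4)))) : Set (P 4 K)))).Nonempty →
      idx D₁ = idx D₂ → D₁ = D₂)
    (Pl : Finset (Fin 4 × (Fin 4 → K) × Finset (Fin 4)))
    (hP1 : ∀ e ∈ Pl, e.1 ∈ S ∧ e.2.1 e.1 = 0 ∧ S ⊆ e.2.2 ∧ CentreBlowup.IsEquimultiplePoint p S e.1 e.2.1 s ∧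
      IsPermissibleCentre p e.2.2 (CentreBlowup.step p S e.1 e.2.1 s).F)
    (hP2 : ∀ e ∈ Pl, ∀ e' ∈ Pl, e ≠ e' →
      (e.1 = e'.1 ∧ ∃ i ∈ e.2.2, i ∈ e'.2.2 ∧ e.2.1 i ≠ e'.2.1 i) ∨
      (e.1 ≠ e'.1 ∧ ((e'.2.1 e.1 = 0 ∧ e.1 ∈ e'.2.2) ∨ (e.2.1 e'.1 = 0 ∧ e'.1 ∈ e.2.2))))
    (Hd : Fin 4 × (Fin 4 → K) × Finset (Fin 4) → Finset (Fin 4 × (Fin 4 → K) × Finset (Fin 4)))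
    (hH1 : ∀ e ∈ Pl, ∀ wt ∈ Hd e, wt.2.1 e.1 = 0 ∧ (∀ i ∈ S, wt.2.1 i = 0) ∧ S.erase e.1 ⊆ wt.2.2 ∧ e.1 ∈ wt.2.2)
    (hH2a : ∀ e ∈ Pl, ∀ wt ∈ Hd e, ∀ e' ∈ Pl, e' ≠ e →
      (e'.1 = e.1 ∧ ∃ i ∈ wt.2.2, i ∈ e'.2.2 ∧ e.2.1 i + wt.2.1 i ≠ e'.2.1 i) ∨
      (e'.1 ≠ e.1 ∧ ((e'.2.1 e.1 = 0 ∧ e.1 ∈ e'.2.2) ∨ (e.2.1 e'.1 + wt.2.1 e'.1 = 0 ∧ e'.1 ∈ wt.2.2))))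
    (hH2c : ∀ e ∈ Pl, ∀ wt ∈ Hd e, ∀ e' ∈ Pl, ∀ wt' ∈ Hd e', (e, wt) ≠ (e', wt') →
      (e'.1 = e.1 ∧ ∃ i ∈ wt.2.2, i ∈ wt'.2.2 ∧ e.2.1 i + wt.2.1 i ≠ e'.2.1 i + wt'.2.1 i) ∨
      (e'.1 ≠ e.1 ∧ ((e'.2.1 e.1 + wt'.2.1 e.1 = 0 ∧ e.1 ∈ wt'.2.2) ∨ (e.2.1 e'.1 + wt.2.1 e'.1 = 0 ∧ e'.1 ∈ wt.2.2))))
    (Wt : Finset (Fin 4 × (Fin 4 → K) × Finset (Fin 4)))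
    (hH2b : ∀ e ∈ Pl, ∀ wt ∈ Hd e, ∀ wt₀ ∈ Wt, wt₀.1 = e.1 → ∃ i ∈ wt.2.2, i ∈ wt₀.2.2 ∧ e.2.1 i + wt.2.1 i ≠ wt₀.2.1 i)
    (hWHd : ∀ e ∈ Pl, ∀ wt ∈ Hd e,
      (p : ℕ∞) ≤ CentreBlowup.ordAlong wt.2.2 (PointBlowup.translate wt.2.1 (CentreBlowup.step p S e.1 e.2.1 s).F))
    (hW1 : ∀ wt ∈ Wt, wt.1 ∈ S ∧ (∀ i ∈ S, wt.2.1 i = 0) ∧ S.erase wt.1 ⊆ wt.2.2 ∧ wt.1 ∉ wt.2.2 ∧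
      IsPermissibleCentre p wt.2.2 (CentreBlowup.step p S wt.1 wt.2.1 s).F)
    (hWH : ∀ wt ∈ Wt, (p : ℕ∞) ≤ CentreBlowup.ordAlong wt.2.2 (PointBlowup.translate wt.2.1 s.F))
    (hW2 : ∀ wt ∈ Wt, ∀ wt' ∈ Wt, wt ≠ wt' → wt.1 = wt'.1 → ∃ i ∈ wt.2.2, i ∈ wt'.2.2 ∧ wt.2.1 i ≠ wt'.2.1 i)
    (hPW : ∀ e ∈ Pl, ∀ wt ∈ Wt, e.1 = wt.1 → ∃ i ∈ e.2.2, i ∈ wt.2.2 ∧ e.2.1 i ≠ wt.2.1 i)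
    (hWsee : ∀ wt ∈ Wt, {x : P 4 K | (X 0 : A 4 K) ∈ x.asIdeal ∧ ∀ i ∈ wt.2.2, (X i.succ - C (wt.2.1 i) : A 4 K) ∈ x.asIdeal} ⊆ Set.range ψ)
    (hWc : ∀ wt ∈ Wt, IsClosed (φ '' (ψ ⁻¹' {x : P 4 K | (X 0 : A 4 K) ∈ x.asIdeal ∧ ∀ i ∈ wt.2.2, (X i.succ - C (wt.2.1 i) : A 4 K) ∈ x.asIdeal})))
    (hWinv : ∀ wt ∈ Wt, ∀ D ∈ M.boundary,
      Disjoint (D.support : Set Z) (φ '' (ψ ⁻¹' {x : P 4 K | (X 0 : A 4 K) ∈ x.asIdeal ∧ ∀ i ∈ wt.2.2, (X i.succ - C (wt.2.1 i) : A 4 K) ∈ x.asIdeal})) ∨ ((D.support : Set Z) ∩ φ '' (ψ ⁻¹' (AffineCoordBlowup.CΛ 4 K (insert 0 (Fin.succ '' (S : Set (Fin 4)))) : Set (P 4 K)))).Nonempty)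
    (L : Finset (Fin 4 × (Fin 4 → K)))
    (hP5 : ∀ (j' : Fin 4) (b' : Fin 4 → K), j' ∈ S → b' j' = 0 → (∀ k ∈ S, k < j' → b' k = 0) →
      CentreBlowup.IsEquimultiplePoint p S j' b' s →
      (∃ e ∈ Pl, e.1 = j' ∧ ∀ i ∈ e.2.2, b' i = e.2.1 i) ∨ (∃ wt ∈ Wt, wt.1 = j' ∧ ∀ i ∈ wt.2.2, b' i = wt.2.1 i) ∨
        (∃ e ∈ Pl, e.1 = j' ∧ ∃ wt ∈ Hd e, ∀ i ∈ wt.2.2, b' i = e.2.1 i + wt.2.1 i) ∨ (j', b') ∈ L) :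
    ∃ (kid : Fin 4 × (Fin 4 → K) × Finset (Fin 4) → Closeds W)
      (rgn : Fin 4 × (Fin 4 → K) × Finset (Fin 4) → Fin 4 × (Fin 4 → K) × Finset (Fin 4) → Closeds W)
      (wkid : Fin 4 × (Fin 4 → K) × Finset (Fin 4) → Closeds W),
      (∀ (e : Fin 4 × (Fin 4 → K) × Finset (Fin 4)) (he : e ∈ Pl),
        Scheme.IsRegular (vanishingIdeal (kid e)).subscheme ∧
        HasSNCWith (M.transform π Zc).boundary (vanishingIdeal (kid e)) ∧
        (∃ (Y'' : Scheme.{0}) (φ'' : Y'' ⟶ W) (ψ'' : Y'' ⟶ P 4 K) (_ : IsOpenImmersion φ'') (_ : IsOpenImmersion ψ''),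
          (M.transform π Zc).ideal.comap φ'' = (hypSheaf p (CentreBlowup.step p S e.1 e.2.1 s).F).comap ψ'' ∧
          (vanishingIdeal (kid e)).comap φ'' =
            (AffineCoordBlowup.𝓘Λ 4 K (insert 0 (Fin.succ '' ((e.2.2 : Finset (Fin 4)) : Set (Fin 4))))).comap ψ'' ∧
          (kid e : Set W) ⊆ Set.range φ'' ∧
          (AffineCoordBlowup.CΛ 4 K (insert 0 (Fin.succ '' ((e.2.2 : Finset (Fin 4)) : Set (Fin 4)))) : Set (P 4 K)) ⊆ Set.range ψ'' ∧
          (∃ (idx₂ : W.IdealSheafData → Fin 4) (cst₂ : W.IdealSheafData → K),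
            (∀ D₂ ∈ (M.transform π Zc).boundary,
              ((D₂.support : Set W) ∩ φ'' '' (ψ'' ⁻¹' (AffineCoordBlowup.CΛ 4 K (insert 0 (Fin.succ '' ((e.2.2 : Finset (Fin 4)) : Set (Fin 4)))) : Set (P 4 K)))).Nonempty →
              D₂.comap φ'' = (ofIdealTop (Ideal.span {(γ 4 K).symm (X (idx₂ D₂).succ + C (cst₂ D₂))})).comap ψ'' ∧
                (idx₂ D₂ ∈ e.2.2 → cst₂ D₂ = 0)) ∧
            (∀ D₁ ∈ (M.transform π Zc).boundary, ∀ D₂ ∈ (M.transform π Zc).boundary,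
              ((D₁.support : Set W) ∩ φ'' '' (ψ'' ⁻¹' (AffineCoordBlowup.CΛ 4 K (insert 0 (Fin.succ '' ((e.2.2 : Finset (Fin 4)) : Set (Fin 4)))) : Set (P 4 K)))).Nonempty →
              ((D₂.support : Set W) ∩ φ'' '' (ψ'' ⁻¹' (AffineCoordBlowup.CΛ 4 K (insert 0 (Fin.succ '' ((e.2.2 : Finset (Fin 4)) : Set (Fin 4)))) : Set (P 4 K)))).Nonempty →
              idx₂ D₁ = idx₂ D₂ → D₁ = D₂)) ∧
          ∀ wt ∈ Hd e, (rgn e wt : Set W) = φ'' '' (ψ'' ⁻¹' {x : P 4 K | (X 0 : A 4 K) ∈ x.asIdeal ∧ ∀ i ∈ wt.2.2, (X i.succ - C (wt.2.1 i) : A 4 K) ∈ x.asIdeal}) ∧ {x : P 4 K | (X 0 : A 4 K) ∈ x.asIdeal ∧ ∀ i ∈ wt.2.2, (X i.succ - C (wt.2.1 i) : A 4 K) ∈ x.asIdeal} ⊆ Set.range ψ'') ∧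
        (kid e : Set W) ⊆ π ⁻¹' (φ '' (ψ ⁻¹' (AffineCoordBlowup.CΛ 4 K (insert 0 (Fin.succ '' (S : Set (Fin 4)))) : Set (P 4 K)))) ∧
        (kid e : Set W).Nonempty ∧
        (∀ wt ∈ Hd e, (rgn e wt : Set W) ⊆ π ⁻¹' (φ '' (ψ ⁻¹' (AffineCoordBlowup.CΛ 4 K (insert 0 (Fin.succ '' (S : Set (Fin 4)))) : Set (P 4 K))))) ∧
        ((∀ D ∈ M.boundary, ((D.support : Set Z) ∩ φ '' (ψ ⁻¹' (AffineCoordBlowup.CΛ 4 K (insert 0 (Fin.succ '' (S : Set (Fin 4)))) : Set (P 4 K)))).Nonempty → idx D ∈ S) →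
          (∀ D₂ ∈ (M.transform π Zc).boundary, ((D₂.support : Set W) ∩ (kid e : Set W)).Nonempty →
            (kid e : Set W) ⊆ D₂.support) ∧
          (∀ wt ∈ Hd e, ∀ D₂ ∈ (M.transform π Zc).boundary,
            Disjoint (D₂.support : Set W) (rgn e wt : Set W) ∨
              ((kid e : Set W) ⊆ D₂.support ∧ (rgn e wt : Set W) ⊆ D₂.support))) ∧
        ∃ Θ : A 4 K ≃ₐ[K] A 4 K, (∀ i : Fin 4, Θ (X i.succ) = X i.succ + C (e.2.1 i)) ∧
          (controlledTransform B (AffineCoordBlowup.𝓘Λ 4 K (insert 0 (Fin.succ '' (S : Set (Fin 4))))) (hypSheaf p s.F) p).comap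
              (Spec.map (CommRingCat.ofHom ((Θ : A 4 K ≃ₐ[K] A 4 K) : A 4 K →+* A 4 K)) ≫
              AffineCoordBlowup.chartImm hB (ChartDictionary.succ_mem_centreVars (hP1 e he).1)) = hypSheaf p (CentreBlowup.step p S e.1 e.2.1 s).F ∧
          (∀ (w : W) (hwV : w ∈ π ⁻¹ᵁ φ.opensRange), w ∈ (kid e : Set W) ↔
            ((B ⁻¹ᵁ ψ.opensRange).ι (ε.hom ⟨w, hwV⟩) : Bl) ∈ (Spec.map (CommRingCat.ofHom ((Θ : A 4 K ≃ₐ[K] A 4 K) : A 4 K →+* A 4 K)) ≫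
              AffineCoordBlowup.chartImm hB (ChartDictionary.succ_mem_centreVars (hP1 e he).1)) '' (AffineCoordBlowup.CΛ 4 K (insert 0 (Fin.succ '' ((e.2.2 : Finset (Fin 4)) : Set (Fin 4)))) : Set (P 4 K))) ∧
          ∀ wt ∈ Hd e,
            (∀ (w : W) (hwV : w ∈ π ⁻¹ᵁ φ.opensRange), w ∈ (rgn e wt : Set W) ↔
              ((B ⁻¹ᵁ ψ.opensRange).ι (ε.hom ⟨w, hwV⟩) : Bl) ∈ (Spec.map (CommRingCat.ofHom ((Θ.trans (AffinePointBlowup.translateEquiv (n := 4) (Fin.cases 0 wt.2.1)) : A 4 K ≃ₐ[K] A 4 K) : A 4 K →+* A 4 K)) ≫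
              AffineCoordBlowup.chartImm hB (ChartDictionary.succ_mem_centreVars (hP1 e he).1)) '' (AffineCoordBlowup.CΛ 4 K (insert 0 (Fin.succ '' ((wt.2.2 : Finset (Fin 4)) : Set (Fin 4)))) : Set (P 4 K))) ∧
            (∀ i : Fin 4, (Θ.trans (AffinePointBlowup.translateEquiv (n := 4) (Fin.cases 0 wt.2.1))) (X i.succ) = X i.succ + C (e.2.1 i + wt.2.1 i)) ∧
            (controlledTransform B (AffineCoordBlowup.𝓘Λ 4 K (insert 0 (Fin.succ '' (S : Set (Fin 4))))) (hypSheaf p s.F) p).comap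
                (Spec.map (CommRingCat.ofHom ((Θ.trans (AffinePointBlowup.translateEquiv (n := 4) (Fin.cases 0 wt.2.1)) : A 4 K ≃ₐ[K] A 4 K) : A 4 K →+* A 4 K)) ≫
              AffineCoordBlowup.chartImm hB (ChartDictionary.succ_mem_centreVars (hP1 e he).1)) = hypSheaf p (PointBlowup.translate wt.2.1 (CentreBlowup.step p S e.1 e.2.1 s).F)) ∧
      (∀ wt ∈ Wt,
        Scheme.IsRegular (vanishingIdeal (wkid wt)).subscheme ∧
        HasSNCWith (M.transform π Zc).boundary (vanishingIdeal (wkid wt)) ∧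
        (∃ (Y'' : Scheme.{0}) (φ'' : Y'' ⟶ W) (ψ'' : Y'' ⟶ P 4 K) (_ : IsOpenImmersion φ'') (_ : IsOpenImmersion ψ''),
          (M.transform π Zc).ideal.comap φ'' = (hypSheaf p (CentreBlowup.step p S wt.1 wt.2.1 s).F).comap ψ'' ∧
          (vanishingIdeal (wkid wt)).comap φ'' =
            (AffineCoordBlowup.𝓘Λ 4 K (insert 0 (Fin.succ '' ((wt.2.2 : Finset (Fin 4)) : Set (Fin 4))))).comap ψ'' ∧
          (wkid wt : Set W) ⊆ Set.range φ'' ∧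
          (AffineCoordBlowup.CΛ 4 K (insert 0 (Fin.succ '' ((wt.2.2 : Finset (Fin 4)) : Set (Fin 4)))) : Set (P 4 K)) ⊆ Set.range ψ'' ∧
          ∃ (idx₂ : W.IdealSheafData → Fin 4) (cst₂ : W.IdealSheafData → K),
            (∀ D₂ ∈ (M.transform π Zc).boundary,
              ((D₂.support : Set W) ∩ φ'' '' (ψ'' ⁻¹' (AffineCoordBlowup.CΛ 4 K (insert 0 (Fin.succ '' ((wt.2.2 : Finset (Fin 4)) : Set (Fin 4)))) : Set (P 4 K)))).Nonempty →
              D₂.comap φ'' = (ofIdealTop (Ideal.span {(γ 4 K).symm (X (idx₂ D₂).succ + C (cst₂ D₂))})).comap ψ'' ∧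
                (idx₂ D₂ ∈ wt.2.2 → cst₂ D₂ = 0)) ∧
            (∀ D₁ ∈ (M.transform π Zc).boundary, ∀ D₂ ∈ (M.transform π Zc).boundary,
              ((D₁.support : Set W) ∩ φ'' '' (ψ'' ⁻¹' (AffineCoordBlowup.CΛ 4 K (insert 0 (Fin.succ '' ((wt.2.2 : Finset (Fin 4)) : Set (Fin 4)))) : Set (P 4 K)))).Nonempty →
              ((D₂.support : Set W) ∩ φ'' '' (ψ'' ⁻¹' (AffineCoordBlowup.CΛ 4 K (insert 0 (Fin.succ '' ((wt.2.2 : Finset (Fin 4)) : Set (Fin 4)))) : Set (P 4 K)))).Nonempty →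
              idx₂ D₁ = idx₂ D₂ → D₁ = D₂)) ∧
        (∀ w ∈ (wkid wt : Set W), π w ∈ φ '' (ψ ⁻¹' {x : P 4 K | (X 0 : A 4 K) ∈ x.asIdeal ∧ ∀ i ∈ wt.2.2, (X i.succ - C (wt.2.1 i) : A 4 K) ∈ x.asIdeal})) ∧
        (wkid wt : Set W).Nonempty) ∧
      (∀ e ∈ Pl, ∀ e' ∈ Pl, e ≠ e' → Disjoint (kid e : Set W) (kid e' : Set W)) ∧
      (∀ e ∈ Pl, ∀ wt ∈ Wt, Disjoint (kid e : Set W) (wkid wt : Set W)) ∧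
      (∀ wt ∈ Wt, ∀ wt' ∈ Wt, wt ≠ wt' → Disjoint (wkid wt : Set W) (wkid wt' : Set W)) ∧
      (∀ e ∈ Pl, ∀ wt ∈ Hd e, ∀ e' ∈ Pl, e' ≠ e → Disjoint (rgn e wt : Set W) (kid e' : Set W)) ∧
      (∀ e ∈ Pl, ∀ wt ∈ Hd e, ∀ wt₀ ∈ Wt, Disjoint (rgn e wt : Set W) (wkid wt₀ : Set W)) ∧
      (∀ e ∈ Pl, ∀ wt ∈ Hd e, ∀ e' ∈ Pl, ∀ wt' ∈ Hd e', (e, wt) ≠ (e', wt') →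
        Disjoint (rgn e wt : Set W) (rgn e' wt' : Set W)) ∧
      (∀ w : W, IsClosed ({w} : Set W) → π w ∈ φ '' (ψ ⁻¹' (AffineCoordBlowup.CΛ 4 K (insert 0 (Fin.succ '' (S : Set (Fin 4)))) : Set (P 4 K))) →
        (p : ℕ∞) ≤ idealOrder (M.transform π Zc).ideal w →
        (∃ e ∈ Pl, w ∈ (kid e : Set W)) ∨ (∃ wt ∈ Wt, w ∈ (wkid wt : Set W)) ∨
        (∃ e ∈ Pl, ∃ wt ∈ Hd e, w ∈ (rgn e wt : Set W)) ∨
        ∃ l ∈ L, l.1 ∈ S ∧ l.2 l.1 = 0 ∧ CentreBlowup.IsEquimultiplePoint p S l.1 l.2 s ∧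
          ∃ (Y' : Scheme.{0}) (φ' : Y' ⟶ W) (ψ' : Y' ⟶ P 4 K) (_ : IsOpenImmersion φ') (_ : IsOpenImmersion ψ')
            (y' : Y'), φ' y' = w ∧ ψ' y' = ξ 4 K ∧
            (M.transform π Zc).ideal.comap φ' = (hypSheaf p (CentreBlowup.step p S l.1 l.2 s).F).comap ψ') ∧
      (∀ w : W, IsClosed ({w} : Set W) → (p : ℕ∞) ≤ idealOrder (M.transform π Zc).ideal w →
        π w ∉ φ '' (ψ ⁻¹' (AffineCoordBlowup.CΛ 4 K (insert 0 (Fin.succ '' (S : Set (Fin 4)))) : Set (P 4 K))) → ∀ wt ∈ Wt, π w ∈ φ '' (ψ ⁻¹' {x : P 4 K | (X 0 : A 4 K) ∈ x.asIdeal ∧ ∀ i ∈ wt.2.2, (X i.succ - C (wt.2.1 i) : A 4 K) ∈ x.asIdeal}) → w ∈ (wkid wt : Set W)) ∧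
      {w : W | IsClosed ({w} : Set W) ∧ π w ∈ φ '' (ψ ⁻¹' (AffineCoordBlowup.CΛ 4 K (insert 0 (Fin.succ '' (S : Set (Fin 4)))) : Set (P 4 K))) ∧
        (p : ℕ∞) ≤ idealOrder (M.transform π Zc).ideal w ∧ (∀ e ∈ Pl, w ∉ (kid e : Set W)) ∧
        (∀ wt ∈ Wt, w ∉ (wkid wt : Set W)) ∧ ∀ e ∈ Pl, ∀ wt ∈ Hd e, w ∉ (rgn e wt : Set W)}.Finite := by
  classical
  -- the children with their regions (part 61c)
  obtain ⟨kid, rgn, hkid, hkdisj, hrkdisj, hrrdisj⟩ := joint_forest_children_hereditary φ ψ ε Zc hπ hB hsq hC' M hmult s hK hS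
    hsee hT hsncZ idx cst hshape hinj Pl hP1 hP2 Hd hH1 hH2a hH2c
  -- model images of points over the host
  have hmodel := fun (w : W) (hw : IsClosed ({w} : Set W)) hwx
      (hord : (p : ℕ∞) ≤ idealOrder (M.transform π Zc).ideal w) =>
    leaf_model_point_normalised φ ψ ε Zc hB hsq M hmult s hK hS.2 hw hwx hord
  -- part 58's shape hypotheses for a waiting entry, from «meets the region ⇒ meets the host»
  have hWshape : ∀ wt ∈ Wt, ∀ D ∈ M.boundary, ((D.support : Set Z) ∩ φ '' (ψ ⁻¹' {x : P 4 K | (X 0 : A 4 K) ∈ x.asIdeal ∧ ∀ i ∈ wt.2.2, (X i.succ - C (wt.2.1 i) : A 4 K) ∈ x.asIdeal})).Nonempty →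
      D.comap φ = (ofIdealTop (Ideal.span {(γ 4 K).symm (X (idx D).succ + C (cst D))})).comap ψ ∧ (idx D ∈ S → cst D = 0) :=
    fun wt hwt D hD hm => by
    rcases hWinv wt hwt D hD with h | h
    · exact absurd (Set.disjoint_iff_inter_eq_empty.mp h) hm.ne_empty
    · exact hshape D hD h
  have hWinj' : ∀ wt ∈ Wt, ∀ D₁ ∈ M.boundary, ∀ D₂ ∈ M.boundary,
      ((D₁.support : Set Z) ∩ φ '' (ψ ⁻¹' {x : P 4 K | (X 0 : A 4 K) ∈ x.asIdeal ∧ ∀ i ∈ wt.2.2, (X i.succ - C (wt.2.1 i) : A 4 K) ∈ x.asIdeal})).Nonempty → ((D₂.support : Set Z) ∩ φ '' (ψ ⁻¹' {x : P 4 K | (X 0 : A 4 K) ∈ x.asIdeal ∧ ∀ i ∈ wt.2.2, (X i.succ - C (wt.2.1 i) : A 4 K) ∈ x.asIdeal})).Nonempty →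
      idx D₁ = idx D₂ → D₁ = D₂ := fun wt hwt D₁ hD₁ D₂ hD₂ hm₁ hm₂ hidx => by
    rcases hWinv wt hwt D₁ hD₁ with h₁ | h₁
    · exact absurd (Set.disjoint_iff_inter_eq_empty.mp h₁) hm₁.ne_empty
    rcases hWinv wt hwt D₂ hD₂ with h₂ | h₂
    · exact absurd (Set.disjoint_iff_inter_eq_empty.mp h₂) hm₂.ne_empty
    exact hinj D₁ hD₁ D₂ hD₂ h₁ h₂ hidx
  -- the waiting kids (part 58)
  have wkidEx := fun (wt : Fin 4 × (Fin 4 → K) × Finset (Fin 4)) (hwt : wt ∈ Wt) =>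
    waiting_kid_package_of_shape φ ψ ε Zc hπ hB hsq hC' M hmult s hK hS.2 hsee hT hsncZ (hW1 wt hwt).1
      ((hW1 wt hwt).2.1 _ (hW1 wt hwt).1) (hW1 wt hwt).2.1 (hW1 wt hwt).2.2.1 (hW1 wt hwt).2.2.2.1 (hWH wt hwt)
      (hW1 wt hwt).2.2.2.2.2 (hWsee wt hwt) (hWc wt hwt) idx cst (hWshape wt hwt) (hWinj' wt hwt)
  let wkid : Fin 4 × (Fin 4 → K) × Finset (Fin 4) → Closeds W := fun wt =>
    if hwt : wt ∈ Wt then (wkidEx wt hwt).choose else ⊥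
  have hwkid : ∀ wt (hwt : wt ∈ Wt), wkid wt = (wkidEx wt hwt).choose := fun wt hwt => dif_pos hwt
  -- membership criteria
  have hin_kid : ∀ e (he : e ∈ Pl) (w : W) (hwV : w ∈ π ⁻¹ᵁ φ.opensRange) (x : P 4 K) (a' : K) (b' : Fin 4 → K)
      (hj' : e.1 ∈ S),
      AffineCoordBlowup.chartImm hB (ChartDictionary.succ_mem_centreVars hj') x = (B ⁻¹ᵁ ψ.opensRange).ι (ε.hom ⟨w, hwV⟩) →
      x.asIdeal = MvPolynomial.vanishingIdeal K {(Fin.cons a' b' : Fin (4 + 1) → K)} →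
      a' ^ p + MvPolynomial.eval b' (CentreBlowup.chartTransform p S e.1 s.F) = 0 →
      (∀ i ∈ e.2.2, b' i = e.2.1 i) → w ∈ (kid e : Set W) := by
    intro e he w hwV x a' b' hj' hxw hx hab hagree
    obtain ⟨-, -, -, -, -, -, -, Θ, hs, hc, hmem, -⟩ := hkid e he
    rw [hmem w hwV, ← hxw]
    exact ChartDictionary.mem_image_CΛ_chart_of_agree (hP1 _ he).1 hs hB hp.out.ne_zero s hS.2
      (hP1 _ he).2.2.2.2.2 hc hx hab hagree
  have hin_rgn : ∀ e (he : e ∈ Pl) wt (hwt : wt ∈ Hd e) (w : W) (hwV : w ∈ π ⁻¹ᵁ φ.opensRange) (x : P 4 K) (a' : K)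
      (b' : Fin 4 → K) (hj' : e.1 ∈ S),
      AffineCoordBlowup.chartImm hB (ChartDictionary.succ_mem_centreVars hj') x = (B ⁻¹ᵁ ψ.opensRange).ι (ε.hom ⟨w, hwV⟩) →
      x.asIdeal = MvPolynomial.vanishingIdeal K {(Fin.cons a' b' : Fin (4 + 1) → K)} →
      a' ^ p + MvPolynomial.eval b' (CentreBlowup.chartTransform p S e.1 s.F) = 0 →
      (∀ i ∈ wt.2.2, b' i = e.2.1 i + wt.2.1 i) → w ∈ (rgn e wt : Set W) := by
    intro e he wt hwt w hwV x a' b' hj' hxw hx hab hagree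
    obtain ⟨-, -, -, -, -, -, -, Θ, -, -, -, hregm⟩ := hkid e he
    obtain ⟨hmemr, hst, hct⟩ := hregm wt hwt
    rw [hmemr w hwV, ← hxw]
    exact ChartDictionary.mem_image_CΛ_chart_of_agree (hP1 _ he).1 hst hB hp.out.ne_zero s hS.2 (hWHd e he wt hwt) hct hx hab
      hagree
  have hin_wkid : ∀ wt (hwt : wt ∈ Wt) (w : W) (hwV : w ∈ π ⁻¹ᵁ φ.opensRange) (x : P 4 K) (a' : K) (b' : Fin 4 → K)
      (hj' : wt.1 ∈ S),
      AffineCoordBlowup.chartImm hB (ChartDictionary.succ_mem_centreVars hj') x = (B ⁻¹ᵁ ψ.opensRange).ι (ε.hom ⟨w, hwV⟩) →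
      x.asIdeal = MvPolynomial.vanishingIdeal K {(Fin.cons a' b' : Fin (4 + 1) → K)} →
      a' ^ p + MvPolynomial.eval b' (CentreBlowup.chartTransform p S wt.1 s.F) = 0 →
      (∀ i ∈ wt.2.2, b' i = wt.2.1 i) → w ∈ (wkid wt : Set W) := by
    intro wt hwt w hwV x a' b' hj' hxw hx hab hagree
    rw [hwkid wt hwt]
    obtain ⟨Θ, hs, hc, hmem, -⟩ := (wkidEx wt hwt).choose_spec
    rw [hmem w hwV, ← hxw]
    exact ChartDictionary.mem_image_CΛ_chart_of_agree (hW1 _ hwt).1 hs hB hp.out.ne_zero s hS.2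
      (hW1 _ hwt).2.2.2.2.2 hc hx hab hagree
  refine ⟨kid, rgn, wkid, hkid, fun wt hwt => ?_, hkdisj, fun e he wt hwt => ?_, fun wt hwt wt' hwt' hne => ?_, hrkdisj,
    fun e he wt hwt wt₀ hwt₀ => ?_, hrrdisj, fun w hw hwx hord => ?_, fun w hw hord hoff wt hwt hwT => ?_, ?_⟩
  · -- data of a waiting kid
    rw [hwkid wt hwt]
    obtain ⟨Θ, -, -, -, hproj, hne, hreg, hsnc, hzig⟩ := (wkidEx wt hwt).choose_spec
    exact ⟨hreg, hsnc, hzig, hproj, hne⟩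
  · -- a child and a waiting kid are disjoint
    rw [hwkid wt hwt]
    obtain ⟨-, -, -, hover, -, -, -, Θ, hs, hc, hmem, -⟩ := hkid e he
    obtain ⟨Θ', hs', hc', hmem', -⟩ := (wkidEx wt hwt).choose_spec
    have hsR : ∀ k : Fin 4, (Θ : A 4 K →+* A 4 K) (X k.succ) = X k.succ + C (e.2.1 k) := fun k => hs k
    have hsR' : ∀ k : Fin 4, (Θ' : A 4 K →+* A 4 K) (X k.succ) = X k.succ + C (wt.2.1 k) := fun k => hs' k
    have hCR : ∀ r : K, (Θ : A 4 K →+* A 4 K) (C r) = C r := fun r => Θ.commutes r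
    have hCR' : ∀ r : K, (Θ' : A 4 K →+* A 4 K) (C r) = C r := fun r => Θ'.commutes r
    refine Set.disjoint_left.mpr fun w hw hw' => ?_
    have hwV : w ∈ π ⁻¹ᵁ φ.opensRange := by obtain ⟨y, -, hy⟩ := hover hw; exact ⟨y, hy⟩
    have h1 := (hmem w hwV).mp hw
    have h2 := (hmem' w hwV).mp hw'
    by_cases hjj : e.1 = wt.1
    · obtain ⟨i, hi, hi', hbi⟩ := hPW e he wt hwt hjj
      have hj₁ := (hP1 e he).1
      obtain ⟨j, b, S₂⟩ := e
      obtain ⟨j', c, T⟩ := wt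
      simp only at hjj hi hi' hbi hsR hsR' h1 h2 hj₁
      subst hjj
      exact Set.disjoint_left.mp (ChartDictionary.disjoint_image_CΛ_chart_of_ne hj₁ hCR hsR hCR' hsR' hB hi hi' hbi) h1 h2
    · have hjT : e.1 ∈ wt.2.2 := (hW1 wt hwt).2.2.1 (Finset.mem_erase.mpr ⟨hjj, (hP1 e he).1⟩)
      exact Set.disjoint_left.mp (ChartDictionary.disjoint_image_CΛ_chart_of_ne_chart (hP1 e he).1 (hW1 wt hwt).1
        hjj hsR' ((hW1 wt hwt).2.1 _ (hP1 e he).1) hB hjT) h1 h2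
  · -- two waiting kids are disjoint
    rw [hwkid wt hwt, hwkid wt' hwt']
    obtain ⟨Θ, hs, hc, hmem, hproj, -⟩ := (wkidEx wt hwt).choose_spec
    obtain ⟨Θ', hs', hc', hmem', -⟩ := (wkidEx wt' hwt').choose_spec
    have hsR : ∀ k : Fin 4, (Θ : A 4 K →+* A 4 K) (X k.succ) = X k.succ + C (wt.2.1 k) := fun k => hs k
    have hsR' : ∀ k : Fin 4, (Θ' : A 4 K →+* A 4 K) (X k.succ) = X k.succ + C (wt'.2.1 k) := fun k => hs' k
    have hCR : ∀ r : K, (Θ : A 4 K →+* A 4 K) (C r) = C r := fun r => Θ.commutes r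
    have hCR' : ∀ r : K, (Θ' : A 4 K →+* A 4 K) (C r) = C r := fun r => Θ'.commutes r
    refine Set.disjoint_left.mpr fun w hw hw' => ?_
    have hwV : w ∈ π ⁻¹ᵁ φ.opensRange := by obtain ⟨y, -, hy⟩ := hproj w hw; exact ⟨y, hy⟩
    have h1 := (hmem w hwV).mp hw
    have h2 := (hmem' w hwV).mp hw'
    by_cases hjj : wt.1 = wt'.1
    · obtain ⟨i, hi, hi', hbi⟩ := hW2 wt hwt wt' hwt' hne hjj
      have hj₁ := (hW1 wt hwt).1
      obtain ⟨j, c, T⟩ := wt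
      obtain ⟨j', c', T'⟩ := wt'
      simp only at hjj hi hi' hbi hsR hsR' h1 h2 hj₁
      subst hjj
      exact Set.disjoint_left.mp (ChartDictionary.disjoint_image_CΛ_chart_of_ne hj₁ hCR hsR hCR' hsR' hB hi hi' hbi) h1 h2
    · have hjT : wt.1 ∈ wt'.2.2 := (hW1 wt' hwt').2.2.1 (Finset.mem_erase.mpr ⟨hjj, (hW1 wt hwt).1⟩)
      exact Set.disjoint_left.mp (ChartDictionary.disjoint_image_CΛ_chart_of_ne_chart (hW1 wt hwt).1 (hW1 wt' hwt').1
        hjj hsR' ((hW1 wt' hwt').2.1 _ (hW1 wt hwt).1) hB hjT) h1 h2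
  · -- a hereditary region and a waiting kid are disjoint
    rw [hwkid wt₀ hwt₀]
    obtain ⟨-, -, -, -, -, hoverr, -, Θ, -, -, -, hregm⟩ := hkid e he
    obtain ⟨hmemr, hst, -⟩ := hregm wt hwt
    obtain ⟨Θ', hs', hc', hmem', -⟩ := (wkidEx wt₀ hwt₀).choose_spec
    have hsR : ∀ k : Fin 4, ((Θ.trans (AffinePointBlowup.translateEquiv (n := 4) (Fin.cases 0 wt.2.1)) : A 4 K ≃ₐ[K] A 4 K) : A 4 K →+* A 4 K) (X k.succ) =
        X k.succ + C ((fun i => e.2.1 i + wt.2.1 i) k) := fun k => hst k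
    have hsR' : ∀ k : Fin 4, (Θ' : A 4 K →+* A 4 K) (X k.succ) = X k.succ + C (wt₀.2.1 k) := fun k => hs' k
    have hCR : ∀ r : K, ((Θ.trans (AffinePointBlowup.translateEquiv (n := 4) (Fin.cases 0 wt.2.1)) : A 4 K ≃ₐ[K] A 4 K) : A 4 K →+* A 4 K) (C r) = C r := fun r => (Θ.trans _).commutes r
    have hCR' : ∀ r : K, (Θ' : A 4 K →+* A 4 K) (C r) = C r := fun r => Θ'.commutes r
    refine Set.disjoint_left.mpr fun w hw hw' => ?_
    have hwV : w ∈ π ⁻¹ᵁ φ.opensRange := by obtain ⟨y, -, hy⟩ := hoverr wt hwt hw; exact ⟨y, hy⟩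
    have h1 := (hmemr w hwV).mp hw
    have h2 := (hmem' w hwV).mp hw'
    by_cases hjj : wt₀.1 = e.1
    · obtain ⟨i, hi, hi', hbi⟩ := hH2b e he wt hwt wt₀ hwt₀ hjj
      have hj₁ := (hP1 e he).1
      obtain ⟨j, b, S₂⟩ := e
      obtain ⟨j', c, T⟩ := wt₀
      simp only at hjj hi hi' hbi hsR hsR' h1 h2 hj₁
      subst hjj
      exact Set.disjoint_left.mp (ChartDictionary.disjoint_image_CΛ_chart_of_ne hj₁ hCR hsR hCR' hsR' hB hi hi' hbi) h1 h2
    · have hjT : e.1 ∈ wt₀.2.2 := (hW1 wt₀ hwt₀).2.2.1 (Finset.mem_erase.mpr ⟨Ne.symm hjj, (hP1 e he).1⟩)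
      exact Set.disjoint_left.mp (ChartDictionary.disjoint_image_CΛ_chart_of_ne_chart (hP1 e he).1 (hW1 wt₀ hwt₀).1
        (Ne.symm hjj) hsR' ((hW1 wt₀ hwt₀).2.1 _ (hP1 e he).1) hB hjT) h1 h2
  · -- FOUR-WAY COVER over the host
    obtain ⟨hwV, j', hj', x, a', b', hxw, hx, hab, hbj', hnorm, heq⟩ := hmodel w hw hwx hord
    rcases hP5 j' b' hj' hbj' hnorm heq with ⟨e, he, hej, hagree⟩ | ⟨wt, hwt, hej, hagree⟩ | ⟨e, he, hej, wt, hwt, hagree⟩ | hl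
    · subst hej; exact Or.inl ⟨e, he, hin_kid e he w hwV x a' b' hj' hxw hx hab hagree⟩
    · subst hej; exact Or.inr (Or.inl ⟨wt, hwt, hin_wkid wt hwt w hwV x a' b' hj' hxw hx hab hagree⟩)
    · subst hej; exact Or.inr (Or.inr (Or.inl ⟨e, he, wt, hwt, hin_rgn e he wt hwt w hwV x a' b' hj' hxw hx hab hagree⟩))
    · obtain ⟨Θ, -, -, -, hchart⟩ := leaf_chart φ ψ ε Zc hB M hmult s hK hS.2 hwV hj' hxw hx hab hbj'
      exact Or.inr (Or.inr (Or.inr ⟨(j', b'), hl, hj', hbj', heq, hchart⟩))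
  · -- a closed order-`p` point off the host over a waiting region lies on the waiting kid
    rw [hwkid wt hwt]
    obtain ⟨Θ, hs, hc, hmem, -⟩ := (wkidEx wt hwt).choose_spec
    have hwV : w ∈ π ⁻¹ᵁ φ.opensRange := by obtain ⟨y, -, hy⟩ := hwT; exact ⟨y, hy⟩
    rw [hmem w hwV]
    refine ιε_mem_image_CΛ_of_off_host φ ψ ε Zc hB hsq M hmult s hK hS.2 (hW1 wt hwt).1 (hW1 wt hwt).2.1
      (hW1 wt hwt).2.2.1 (hW1 wt hwt).2.2.2.1 hs (hW1 wt hwt).2.2.2.2.2 hc hw hwV hord hoff ?_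
    obtain ⟨y, hy, hyw⟩ := hwT
    exact ⟨y, fun i hi => hy.2 i hi, hyw⟩
  · -- the leaf points are finitely many: they inject into `L`
    have cover : ∀ w : W, IsClosed ({w} : Set W) → π w ∈ φ '' (ψ ⁻¹' (AffineCoordBlowup.CΛ 4 K (insert 0 (Fin.succ '' (S : Set (Fin 4)))) : Set (P 4 K))) →
        (p : ℕ∞) ≤ idealOrder (M.transform π Zc).ideal w → (∀ e ∈ Pl, w ∉ (kid e : Set W)) →
        (∀ wt ∈ Wt, w ∉ (wkid wt : Set W)) → (∀ e ∈ Pl, ∀ wt ∈ Hd e, w ∉ (rgn e wt : Set W)) →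
        ∃ l : Fin 4 × (Fin 4 → K), l ∈ L ∧ ∃ (hwV : w ∈ π ⁻¹ᵁ φ.opensRange) (hj : l.1 ∈ S) (x : P 4 K) (a : K),
          AffineCoordBlowup.chartImm hB (ChartDictionary.succ_mem_centreVars hj) x =
              (B ⁻¹ᵁ ψ.opensRange).ι (ε.hom ⟨w, hwV⟩) ∧
            x.asIdeal = MvPolynomial.vanishingIdeal K {(Fin.cons a l.2 : Fin (4 + 1) → K)} ∧
              a ^ p + MvPolynomial.eval l.2 (CentreBlowup.chartTransform p S l.1 s.F) = 0 := by
      intro w hw hwx hord hout houtw houtr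
      obtain ⟨hwV, j', hj', x, a', b', hxw, hx, hab, hbj', hnorm, heq⟩ := hmodel w hw hwx hord
      rcases hP5 j' b' hj' hbj' hnorm heq with ⟨e, he, hej, hagree⟩ | ⟨wt, hwt, hej, hagree⟩ | ⟨e, he, hej, wt, hwt, hagree⟩ | hl
      · subst hej; exact absurd (hin_kid e he w hwV x a' b' hj' hxw hx hab hagree) (hout e he)
      · subst hej; exact absurd (hin_wkid wt hwt w hwV x a' b' hj' hxw hx hab hagree) (houtw wt hwt)
      · subst hej; exact absurd (hin_rgn e he wt hwt w hwV x a' b' hj' hxw hx hab hagree) (houtr e he wt hwt)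
      · exact ⟨(j', b'), hl, hwV, hj', x, a', hxw, hx, hab⟩
    let g : W → Fin 4 × (Fin 4 → K) := fun w =>
      if hc : IsClosed ({w} : Set W) ∧ π w ∈ φ '' (ψ ⁻¹' (AffineCoordBlowup.CΛ 4 K (insert 0 (Fin.succ '' (S : Set (Fin 4)))) : Set (P 4 K))) ∧
          (p : ℕ∞) ≤ idealOrder (M.transform π Zc).ideal w ∧ (∀ e ∈ Pl, w ∉ (kid e : Set W)) ∧
          (∀ wt ∈ Wt, w ∉ (wkid wt : Set W)) ∧ ∀ e ∈ Pl, ∀ wt ∈ Hd e, w ∉ (rgn e wt : Set W)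
      then (cover w hc.1 hc.2.1 hc.2.2.1 hc.2.2.2.1 hc.2.2.2.2.1 hc.2.2.2.2.2).choose else ((0 : Fin 4), (0 : Fin 4 → K))
    refine Set.Finite.of_finite_image (f := g) ((Finset.finite_toSet L).subset ?_) ?_
    · rintro _ ⟨w, hw, rfl⟩
      have hg : g w = (cover w hw.1 hw.2.1 hw.2.2.1 hw.2.2.2.1 hw.2.2.2.2.1 hw.2.2.2.2.2).choose := dif_pos hw
      rw [hg]
      exact (cover w hw.1 hw.2.1 hw.2.2.1 hw.2.2.2.1 hw.2.2.2.2.1 hw.2.2.2.2.2).choose_spec.1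
    · intro w hw w' hw' hgg
      have hg : g w = (cover w hw.1 hw.2.1 hw.2.2.1 hw.2.2.2.1 hw.2.2.2.2.1 hw.2.2.2.2.2).choose := dif_pos hw
      have hg' : g w' = (cover w' hw'.1 hw'.2.1 hw'.2.2.1 hw'.2.2.2.1 hw'.2.2.2.2.1 hw'.2.2.2.2.2).choose := dif_pos hw'
      have key : ∀ l l' : Fin 4 × (Fin 4 → K), l = l' →
          (∃ (hwV : w ∈ π ⁻¹ᵁ φ.opensRange) (hj : l.1 ∈ S) (x : P 4 K) (a : K),
            AffineCoordBlowup.chartImm hB (ChartDictionary.succ_mem_centreVars hj) x =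
                (B ⁻¹ᵁ ψ.opensRange).ι (ε.hom ⟨w, hwV⟩) ∧
              x.asIdeal = MvPolynomial.vanishingIdeal K {(Fin.cons a l.2 : Fin (4 + 1) → K)} ∧
                a ^ p + MvPolynomial.eval l.2 (CentreBlowup.chartTransform p S l.1 s.F) = 0) →
          (∃ (hwV : w' ∈ π ⁻¹ᵁ φ.opensRange) (hj : l'.1 ∈ S) (x : P 4 K) (a : K),
            AffineCoordBlowup.chartImm hB (ChartDictionary.succ_mem_centreVars hj) x =
                (B ⁻¹ᵁ ψ.opensRange).ι (ε.hom ⟨w', hwV⟩) ∧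
              x.asIdeal = MvPolynomial.vanishingIdeal K {(Fin.cons a l'.2 : Fin (4 + 1) → K)} ∧
                a ^ p + MvPolynomial.eval l'.2 (CentreBlowup.chartTransform p S l'.1 s.F) = 0) →
          w = w' := by
        rintro l _ rfl ⟨hwV, hj, x, a, hxw, hx, hab⟩ ⟨hwV', hj', x', a', hxw', hx', hab'⟩
        have haa : a = a' := frobenius_inj K p (by
          rw [frobenius_def, frobenius_def, eq_neg_of_add_eq_zero_left hab, eq_neg_of_add_eq_zero_left hab'])
        have hxx : x = x' := PrimeSpectrum.ext (by rw [hx, hx', haa])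
        subst hxx
        have h1 : (B ⁻¹ᵁ ψ.opensRange).ι (ε.hom ⟨w, hwV⟩) = (B ⁻¹ᵁ ψ.opensRange).ι (ε.hom ⟨w', hwV'⟩) :=
          hxw.symm.trans hxw'
        have h2 := ε.hom.isOpenEmbedding.injective ((B ⁻¹ᵁ ψ.opensRange).ι.isOpenEmbedding.injective h1)
        exact Subtype.ext_iff.mp h2
      exact key _ _ (hg.symm.trans (hgg.trans hg')) (cover w hw.1 hw.2.1 hw.2.2.1 hw.2.2.2.1 hw.2.2.2.2.1 hw.2.2.2.2.2).choose_spec.2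
        (cover w' hw'.1 hw'.2.1 hw'.2.2.1 hw'.2.2.2.1 hw'.2.2.2.2.1 hw'.2.2.2.2.2).choose_spec.2

end StepH

end Equimultiple

end Summit.ResolutionOfSingularities.ResolutionOfSingularities.Theorems.PIDim4

end
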